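import Summits.QuantumAdvantage.QuantumAdvantage.Theses.ArithStatLadder
import Summits.QuantumAdvantage.QuantumAdvantage.Theorems.DigitRung.Negative.Reduction
import Summits.QuantumAdvantage.QuantumAdvantage.Theorems.DigitRung.Negative.WalshAndIndependence
import Summits.QuantumAdvantage.QuantumAdvantage.Theorems.DigitRung.Negative.TwoAdicDigitBalance
import Literature.NumberTheory.CubicFields.BinaryCubicForms
import Literature.NumberTheory.CubicFields.UniformityEstimate
import Literature.NumberTheory.QuadraticFields.ThreeTorsion
import Literature.NumberTheory.QuadraticFields.ThreeTorsionMean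
import Literature.NumberTheory.Sieve.VinogradovExpSumTools
import Literature.NumberTheory.DiophantineApproximation.RationalsNearSeparatedPoints

/-!
# Sketch (crux-ideate r1 k2, gen 2): first lemmas of the idea `isobaric-bilinear-dispersion`
for the crux `ArithStatLadder.DigitRung` (stmt-QuantumAdvantage-2423).

Nothing here is proposed to the tree; `def … : Prop` are STATEMENTS (first lemmas / stubs-to-be),
the `theorem`s are the algebraic identities the lever rests on, kernel-checked.

§1  The lever's algebra: `Disc` is isobaric of weight 6, hence AFFINE-BILINEAR in the extreme pair
    `(a, d)` modulo the single outer term `-27 (ad)^2`; the cross difference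
    `Disc(a,b,c,d) − Disc(a,b',c',d)` is `18·ad·Δ₁ − 4·a·Δ₂ − 4·d·Δ₃ + Δ₀`.
§2  Currency: `eR`, box Weyl sums `discBoxSum` over translated/dilated boxes, hyperbolic sums.
§3  First lemma `BilinearBoxLemma` + its elementary engines (`ShiftedMinLemma`, `MajorDifferencesRare`,
    `ProductDifferenceCount` — the first two are corollaries of PROVED tree lemmas) and the
    Cauchy–Schwarz step `CauchySchwarzOuterPair`.
§4  Milestone in the common currency of the other cards: `IsobaricBilinearWeyl := TorsionWeylBound 0 1`.
§5  Recorded line shape (statements only).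
-/

noncomputable section

namespace Summit.QuantumAdvantage.QuantumAdvantage.Cruxes.DigitRung.IdeasK2G2

set_option linter.dupNamespace false

open scoped BigOperators Classical
open Literature.NumberTheory.CubicFields Literature.NumberTheory.QuadraticFields
open Literature.NumberTheory.Sieve.Vinogradov (distInt geomBound)
open Summit.QuantumAdvantage.QuantumAdvantage.Theses.ArithStatLadder (DigitRung)

/-! ## §1 The isobaric affine-bilinear structure of `Disc` in the extreme pair `(a, d)` -/

/-- **The lever.** `Disc = −27(ad)² + 18(bc)(ad) − 4c³·a − 4b³·d + b²c²`: the extreme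
coefficients enter only through `1, a, d, ad, (ad)²` (isobaric weight `6`: a monomial
`a^{e₀} b^{e₁} c^{e₂} d^{e₃}` of `Disc` has `Σ eᵢ = 4`, `e₁ + 2e₂ + 3e₃ = 6`). -/
theorem disc_outer_affine_bilinear {R : Type*} [CommRing R] (f : BinaryCubic R) :
    f.disc = -27 * (f.a * f.d) ^ 2 + 18 * (f.b * f.c) * (f.a * f.d) + (-4 * f.c ^ 3) * f.a
      + (-4 * f.b ^ 3) * f.d + f.b ^ 2 * f.c ^ 2 := by
  rw [BinaryCubic.disc_eq]; ring

/-- **Cross difference is bilinear in `(a, d)`.** For two inner points `(b,c)`, `(b',c')` and the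
same outer point `(a,d)`:
`Disc(a,b,c,d) − Disc(a,b',c',d) = 18·ad·(bc − b'c') − 4a·(c³ − c'³) − 4d·(b³ − b'³) + (b²c² − b'²c'²)`;
the outer term `−27(ad)²` CANCELS. This is what one Cauchy–Schwarz over `(a,d)` produces. -/
theorem disc_cross_difference {R : Type*} [CommRing R] (a d b c b' c' : R) :
    (⟨a, b, c, d⟩ : BinaryCubic R).disc - (⟨a, b', c', d⟩ : BinaryCubic R).disc
      = 18 * (a * d) * (b * c - b' * c') - 4 * a * (c ^ 3 - c' ^ 3) - 4 * d * (b ^ 3 - b' ^ 3)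
        + (b ^ 2 * c ^ 2 - b' ^ 2 * c' ^ 2) := by
  simp only [BinaryCubic.disc_eq]; ring

/-- **Stability under translation and odd dilation** (needed for sieve classes `x ≡ x₀ (mod m)` and
for Bhargava's translated boxes): for `x = x₀ + m·y` the cross difference in the new variables is
again `κ·(a d) + μ·a + ν·d + const` with `κ = 18 m⁴ (bc − b'c')` computed from the ACTUAL inner
values `b = b₀ + m b₁`, … — i.e. the structure of `disc_cross_difference` is intrinsic. We record the
instance used: translating all four coordinates. -/
theorem disc_cross_difference_translate {R : Type*} [CommRing R]
    (a₀ b₀ c₀ d₀ m a d b c b' c' : R) :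
    (⟨a₀ + m * a, b₀ + m * b, c₀ + m * c, d₀ + m * d⟩ : BinaryCubic R).disc
      - (⟨a₀ + m * a, b₀ + m * b', c₀ + m * c', d₀ + m * d⟩ : BinaryCubic R).disc
      = 18 * ((a₀ + m * a) * (d₀ + m * d)) * ((b₀ + m * b) * (c₀ + m * c) - (b₀ + m * b') * (c₀ + m * c'))
        - 4 * (a₀ + m * a) * ((c₀ + m * c) ^ 3 - (c₀ + m * c') ^ 3)
        - 4 * (d₀ + m * d) * ((b₀ + m * b) ^ 3 - (b₀ + m * b') ^ 3)
        + ((b₀ + m * b) ^ 2 * (c₀ + m * c) ^ 2 - (b₀ + m * b') ^ 2 * (c₀ + m * c') ^ 2) :=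
  disc_cross_difference _ _ _ _ _ _

/-- `ad` and `bc` are the invariants of the torus `(a,b,c,d) ↦ (t⁻³a, t⁻¹b, tc, t³d)` that skews
Bhargava's boxes: the split `(a,d) | (b,c)` is balanced (`#outer = #inner = X^{1/2}`) uniformly in
the cusp parameter. Recorded as the algebraic identity on monomials. -/
theorem torus_invariants {R : Type*} [Field R] (t a b c d : R) (ht : t ≠ 0) :
    (t⁻¹ ^ 3 * a) * (t ^ 3 * d) = a * d ∧ (t⁻¹ * b) * (t * c) = b * c := by
  constructor <;> field_simp

/-- Sanity instance of `disc_outer_affine_bilinear` at `f = u³ − uv² + v³` (`Disc = −23`). -/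
example : (⟨1, 0, -1, 1⟩ : BinaryCubic ℤ).disc = -23 := by simp [BinaryCubic.disc_eq]

/-! ## §2 Currency -/

/-- `e(x) = exp(2πix)`. -/
def eR (x : ℝ) : ℂ := Complex.exp (2 * Real.pi * Complex.I * x)

/-- Distance to the nearest integer: the tree's `Vinogradov.distInt` (`|x − round x|`), with
`geomBound V x = min (V, 1/(2‖x‖))` the geometric-series majorant (`norm_sum_Ioc_fourierChar_le_geomBound`). -/
example (x : ℝ) : distInt x = |x - round x| := rfl

/-- The box Weyl sum of the discriminant over the translated/dilated box
`{x₀ + m·(a,b,c,d) : a < A, b < B, c < C, d < D}` at frequency `α`: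
`Σ e(α · Disc(x₀ + m x))`. (`m = 1`, `x₀ = lo` is a plain box with lower corner `lo`.) -/
def discBoxSum (x₀ : BinaryCubic ℤ) (m A B C D : ℕ) (α : ℝ) : ℂ :=
  ∑ a ∈ Finset.range A, ∑ b ∈ Finset.range B, ∑ c ∈ Finset.range C, ∑ d ∈ Finset.range D,
    eR (α * ((⟨x₀.a + m * a, x₀.b + m * b, x₀.c + m * c, x₀.d + m * d⟩ : BinaryCubic ℤ).disc : ℤ))

/-- The hyperbolic (affine-bilinear) exponential sum `Σ_{a<A} Σ_{d<D} e(κ·ad + μ·a + ν·d)` — what is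
left of the `(a,d)`-sum after Cauchy–Schwarz; a geometric series in `d` for each `a`. -/
def hyperbolicSum (A D : ℕ) (κ μ ν : ℝ) : ℂ :=
  ∑ a ∈ Finset.range A, ∑ d ∈ Finset.range D, eR (κ * a * d + μ * a + ν * d)

/-! ## §3 First lemma and its engines -/

/-- **Cauchy–Schwarz over the outer pair** (exact inequality, no arithmetic): for the box sum,
`|S|² ≤ (A·D) · Σ_{(b,c),(b',c')} |hyperbolicSum A D κ μ ν|` with
`κ = 18 α m⁴·(bc − b'c')`-type derived frequency read off `disc_cross_difference_translate`
(here packaged abstractly: any phase `Φ(x,y) = R(x) + ⟨φ(x), ψ(y)⟩` with `φ(a,d) = (ad, a, d)`). -/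
def CauchySchwarzOuterPair : Prop :=
  ∀ (A D : ℕ) (Y : Finset (ℤ × ℤ)) (R : ℕ → ℕ → ℝ) (ψ₁ ψ₂ ψ₃ ψ₀ : ℤ × ℤ → ℝ),
    ‖∑ a ∈ Finset.range A, ∑ d ∈ Finset.range D, ∑ y ∈ Y,
        eR (R a d + ψ₁ y * a * d + ψ₂ y * a + ψ₃ y * d + ψ₀ y)‖ ^ 2
      ≤ (A * D : ℝ) * ∑ y ∈ Y, ∑ y' ∈ Y,
          ‖hyperbolicSum A D (ψ₁ y - ψ₁ y') (ψ₂ y - ψ₂ y') (ψ₃ y - ψ₃ y')‖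

/-- **Shifted min-lemma** (Vinogradov; Vaughan *The Hardy–Littlewood method* Lemma 2.2,
Nathanson GTM 164 Lemma 4.10 with constant weights): if `|κ − s/q| ≤ 1/q²`, `(s,q) = 1`, then
`Σ_{a<A} min(D, 1/(2‖κa + ν‖)) ≤ C₀ (A/q + 1)(D + q(1 + log q))`, uniformly in the shift `ν`.
A ~30-line COROLLARY of PROVED tree lemmas: split `a` into blocks of length `⌊q/2⌋ + 1`; inside a
block the points `κa + ν` are pairwise `1/(2q)`-separated (`Vinogradov.le_distInt_mul_of_abs_le`,
the shift cancels in differences), so each block contributes `≤ 2D + 2q(1 + log q)`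
(`Vinogradov.sum_geomBound_le_of_separated`). It bounds `‖hyperbolicSum A D κ μ ν‖` after the
geometric series in `d` (`Vinogradov.norm_sum_Ioc_fourierChar_le_geomBound`). -/
def ShiftedMinLemma : Prop :=
  ∃ C₀ : ℝ, ∀ (A D q : ℕ) (s : ℤ) (κ ν : ℝ), 1 ≤ q → IsCoprime s (q : ℤ) →
    |κ - s / q| ≤ 1 / (q : ℝ) ^ 2 →
      ∑ a ∈ Finset.range A, geomBound (D : ℝ) (κ * a + ν)
        ≤ C₀ * ((A : ℝ) / q + 1) * (D + q * (1 + Real.log q))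

/-- **Bad inner pairs are rare** — the counting device is ALREADY PROVED in the tree:
`Literature/NumberTheory/DiophantineApproximation/RationalsNearSeparatedPoints.lean`,
`card_filter_exists_near_rational_le` (points of a `δ`-separated set of reals in an interval of
length `Λ` lying within `η` of a rational with denominator in `[Q₁, Q₂)` number
`≤ (Q₂ − Q₁)(Q₂(Λ + 2η) + 1)(2η/δ + 1)`), applied to the arithmetic progression
`P = {18 r m⁴ Δ / 2^k : |Δ| ≤ 2M}` (`δ = 18|r|m⁴/2^k`, `Λ = 72|r|m⁴M/2^k`, `η = 1/Q`,
`Q = AD·M^{−δ₀}`, `Q₂ = M^{δ₀}`): the number of `Δ = bc − b'c'` whose derived frequency is major is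
`≪ M^{3δ₀} + |r|m⁴M^{1+2δ₀}2^{−k} + 2^k M^{2δ₀−1}/|r|` — a fraction `M^{−δ₀}` of all `Δ` exactly
when `M^{4δ₀} ≲ 2^k ≲ M^{2−4δ₀}`. Recorded here as the resulting statement. -/
def MajorDifferencesRare : Prop :=
  ∀ δ₀ : ℝ, 0 < δ₀ → ∃ C : ℝ, ∀ (M k : ℕ) (r : ℤ) (m : ℕ), r ≠ 0 → 1 ≤ m →
    (((Finset.Icc (-(2 * M : ℤ)) (2 * M)).filter (fun Δ : ℤ =>
        ∃ q : ℕ, 1 ≤ q ∧ (q : ℝ) ≤ (M : ℝ) ^ δ₀ ∧ ∃ s : ℤ,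
          |(18 * r * (m : ℝ) ^ 4 * Δ / (2 : ℝ) ^ k) - s / q| ≤ (M : ℝ) ^ δ₀ / (q * M))).card : ℝ)
      ≤ C * ((M : ℝ) ^ (3 * δ₀) + |(r : ℝ)| * (m : ℝ) ^ 4 * (M : ℝ) ^ (1 + 2 * δ₀) / (2 : ℝ) ^ k
              + (2 : ℝ) ^ k * (M : ℝ) ^ (2 * δ₀ - 1) / |(r : ℝ)| + (M : ℝ) ^ δ₀)

/-- **Product-difference count** (divisor-type bound for the inner pairs): the number of
`(b, c, b', c')` in a box `[B] × [C] × [B] × [C]` with `bc − b'c' = Δ` is `≪_ε (BC)^{1+ε} + B² + C²`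
uniformly in `Δ` (for `Δ = 0` included). -/
def ProductDifferenceCount : Prop :=
  ∀ ε : ℝ, 0 < ε → ∃ C : ℝ, ∀ (B C' : ℕ) (Δ : ℤ),
    ((((Finset.range B ×ˢ Finset.range C') ×ˢ (Finset.range B ×ˢ Finset.range C')).filter
        (fun p : (ℕ × ℕ) × (ℕ × ℕ) =>
          (p.1.1 : ℤ) * p.1.2 - (p.2.1 : ℤ) * p.2.2 = Δ)).card : ℝ)
      ≤ C * (((B : ℝ) * C') ^ (1 + ε) + (B : ℝ) ^ 2 + (C' : ℝ) ^ 2)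

/-- **FIRST LEMMA — the bilinear box lemma.** For every `δ ∈ (0, 1/10)` there are `κ > 0`, `C`
such that for every translated box `x₀ + m·([A]×[B]×[C]×[D])` with odd `m ≤ M^δ`, all sides in
`[M^δ, M^{1−δ}]`, `AD ≤ M`, `BC ≤ M`, every odd `r` with `|r| ≤ M^δ` and every `k` with
`M^{8δ} ≤ 2^k ≤ M^{2−8δ}`:  `|Σ_{x in box} e(r·Disc(x)/2^k)| ≤ C·M^{2−κ}` (trivial bound `≍ M²`).
Proof sketch (card §Lever): Cauchy–Schwarz over `(a,d)` (`disc_cross_difference_translate`) →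
hyperbolic sums with derived frequency `κ = 18 r m⁴ (bc − b'c')/2^k` → geometric series in `d` +
`ShiftedMinLemma` in `a` after Dirichlet approximation of `κ` (`Real.exists_rat_abs_sub_le_and_den_le`)
with `Q = AD·M^{−δ}` → the inner pairs whose `κ` is major (`q ≤ M^δ`) are few by
`MajorDifferencesRare` × `ProductDifferenceCount`: a fraction
`≪ M^{2δ−1} + |r| m⁴ M^{2δ} 2^{−k} + 2^k M^{2δ−2}` of all `Δ = bc − b'c'`. In the application
`M ≍ X^{1/2}`, so the window is `X^{4δ} ≤ 2^k ≤ X^{1−4δ}`: the whole open band and both printed ends. -/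
def BilinearBoxLemma : Prop :=
  ∀ δ : ℝ, 0 < δ → δ < 1 / 10 → ∃ κ : ℝ, 0 < κ ∧ ∃ C : ℝ,
    ∀ (x₀ : BinaryCubic ℤ) (m M A B C' D k : ℕ) (r : ℤ),
      Odd m → Odd r → (m : ℝ) ≤ (M : ℝ) ^ δ → |(r : ℝ)| ≤ (M : ℝ) ^ δ →
      (M : ℝ) ^ δ ≤ A → (M : ℝ) ^ δ ≤ B → (M : ℝ) ^ δ ≤ C' → (M : ℝ) ^ δ ≤ D →
      (A : ℝ) * D ≤ M → (B : ℝ) * C' ≤ M →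
      (M : ℝ) ^ (8 * δ) ≤ (2 : ℝ) ^ k → (2 : ℝ) ^ k ≤ (M : ℝ) ^ (2 - 8 * δ) →
        ‖discBoxSum x₀ m A B C' D ((r : ℝ) / (2 : ℝ) ^ k)‖ ≤ C * (M : ℝ) ^ (2 - κ)

/-! ## §4 Milestone in the common currency (shared with the other cards on this crux) -/

/-- The digit Weyl sum of the centred 3-torsion over imaginary quadratic discriminants `−X < D < 0`
(`D` fundamental): `Σ (#Cl₃(D) − 2)·e(rD/2^k)`. By `Negative.digitRung_iff_canonical` only the
canonical statistic `quadFieldThreeTorsion` matters (this is where the crux's `Pins` hypothesis is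
used — `Negative.digitRung_false_without_pins`). -/
def torsionWeylSum (X k : ℕ) (r : ℤ) : ℂ :=
  ∑ D ∈ negFundDiscrs X, (((quadFieldThreeTorsion D : ℝ) - 2 : ℝ) : ℂ) * eR ((r : ℝ) * D / (2 : ℝ) ^ k)

/-- Power-saving minor-arc bound on the dyadic window `X^{lo+δ} ≤ 2^k ≤ X^{hi−δ}` (same currency as
the cards `birch-singular-locus`, `two-adic-differencing`, `hessian-poisson-upper-band`). -/
def TorsionWeylBound (lo hi : ℝ) : Prop :=
  ∀ δ : ℝ, 0 < δ → ∀ r : ℤ, Odd r → ∃ κ : ℝ, 0 < κ ∧ ∃ C : ℝ, ∀ X k : ℕ,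
    (X : ℝ) ^ (lo + δ) ≤ (2 : ℝ) ^ k → (2 : ℝ) ^ k ≤ (X : ℝ) ^ (hi - δ) →
      ‖torsionWeylSum X k r‖ ≤ C * (X : ℝ) ^ (1 - κ)

/-- **Milestone of this line**: the full window `(X^{0+}, X^{1−})` from ONE lemma. -/
def IsobaricBilinearWeyl : Prop := TorsionWeylBound 0 1

/-! ## §5 Recorded line shape (statements only; the crux-plan turns these into stubs) -/

/-- The low-digit input shared with the route's support item `EndJuntaRung`: Davenport–Heilbronn
mean `2` in every FIXED residue class of `−D` modulo a FIXED power of two (BST Thm 20 + §8.5 /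
Taniguchi–Thorne CJM Thm 1.5, `4 ∣ m`; NOT the tree's `tt_threeTorsion_sum_progression`, which
needs `gcd(6a, m) = 1` — `Negative.gcd_six_mul_two_pow_ne_one`). -/
def DyadicClassMeanTwo : Prop :=
  ∀ (k₀ : ℕ) (u : ℤ), ∀ ε : ℝ, 0 < ε → ∀ᶠ n : ℕ in Filter.atTop,
    |∑ D ∈ ((negFundDiscrs (2 ^ n)) \ (negFundDiscrs (2 ^ (n - 1)))).filter
        (fun D => D ≡ u [ZMOD (2 ^ k₀ : ℕ)]), ((quadFieldThreeTorsion D : ℝ) - 2)|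
      ≤ ε * (((negFundDiscrs (2 ^ n)) \ (negFundDiscrs (2 ^ (n - 1)))).card : ℝ)

/-- Trunk (shared with every lattice-point line on this crux; Bhargava averaging over translated
boxes truncated at height `X^η`, reducible forms `O(X^{3/4+ε})`, fundamental-discriminant sieve by
classes mod odd `m² ≤ X^{2η}` with tail `btt_uniformity_sqDvd`, and the Hasse/HCL-I dictionary
`#Cl₃(D) − 1 = 2·#{cubic fields of disc D}`): the box lemma gives the milestone. -/
def TrunkShape : Prop := BilinearBoxLemma → btt_uniformity_sqDvd → IsobaricBilinearWeyl

/-- Glue (elementary: Fejér/Erdős–Turán for the square wave with nonnegative weights `t`, plus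
`Negative.concl_iff_total_and_walsh`; the top `O(1)` digits from `btt_threeTorsion_sum`, the bottom
`O(1)` digits from `DyadicClassMeanTwo`; everything in between from the milestone). -/
def GlueShape : Prop :=
  IsobaricBilinearWeyl → btt_threeTorsion_sum → DyadicClassMeanTwo → DigitRung

end Summit.QuantumAdvantage.QuantumAdvantage.Cruxes.DigitRung.IdeasK2G2

end
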